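import Summits.Ventures.PercRepro.S2SetCountQuart

/-!
# PercRepro — S2: THE GRADED PARTITION COUNT — the maximal closure class explicit (p7, gen 13; sub-claim S2; the cells `(14, 8 … 11)`)

S2SetCountQuart's partition count weighs every spanning `(q + 1)`-set by `C(f − (q + 1), j)/quart(j + 1)` — the rank-`q`
`(q + 1 + j)`-supersets inside a closure of the largest allowed size `f`. Here the spanning sets are split into the class with a
MAXIMAL closure (`|cl S| = f`) and the rest (`|cl S| ≤ f − 1`): **`mul_card_levelF_le_classes_graded`** — `quart(m − q)·#levelF(q, m)
≤ #rest·C(f − 1 − (q + 1), m − (q + 1)) + #max·C(f − (q + 1), m − (q + 1))`, and **`ncard_eRk_eq_ncard_le_le_sets_indep_graded`** —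
`#{B : ρ(B) = q, |B| ≤ D} ≤ #{independent q-sets} + σ_lo·Σ_k s_k·C(n − k, q + 1 − k) + (σ_hi − σ_lo)·N` for any `N ≥ #max`, with
`σ_lo = Σ_j C(f − 1 − (q + 1), j)/quart(j + 1)` and `σ_hi = Σ_j C(f − (q + 1), j)/quart(j + 1)`. The bound on `#max` through the
circuits and the maximal extensions of the rank-`4` flats is S2MaxExtensionCount. Axioms: standard.
-/

open scoped Matroid

namespace PercRepro

namespace S2

open Set Finset

variable {α : Type} {M : Matroid α}

/-- The free points of a spanning `(q + 1)`-set: `|cl S ∖ S| = |cl S| − (q + 1)`. -/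
theorem ncard_closure_diff_of_mem_spanAll [M.Finite] {q : ℕ} {S : Set α} (hS : S ∈ spanAll M q) :
    (M.closure S \ S).ncard = (M.closure S).ncard - (q + 1) := by
  obtain ⟨hSE, hSc, -⟩ := mem_spanAll.1 hS
  rw [Set.ncard_sdiff (M.subset_closure S hSE) (M.ground_finite.subset hSE), hSc]

open scoped Classical in
/-- **The level count by the two closure classes** (maximal closure `|cl S| = f` / the rest `|cl S| ≤ f − 1`):
`quart(m − q)·#levelF(q, m) ≤ #rest·C(f − 1 − (q + 1), m − (q + 1)) + #max·C(f − (q + 1), m − (q + 1))`. -/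
theorem mul_card_levelF_le_classes_graded [M.Finite] (q f : ℕ) (hq : 1 ≤ q)
    (hcirc : ∀ C, M.IsCircuit C → 3 ≤ C.encard) (hC1 : ∀ L ⊆ M.E, M.eRk L = 2 → L.ncard ≤ 3)
    (hC2 : ∀ L ⊆ M.E, M.eRk L ≤ 3 → L.ncard ≤ 6)
    (hflat : ∀ X ⊆ M.E, M.eRk X ≤ q → X.ncard ≤ f) (m : ℕ) :
    ((m - q) + 3 * (m - q).choose 2 + 3 * (m - q).choose 3 + 2 * (m - q).choose 4) * (Matroid.levelF M q m).card ≤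
      ((spanAll M q).filter (fun S => ¬ (M.closure S).ncard = f)).card * (f - 1 - (q + 1)).choose (m - (q + 1)) +
        ((spanAll M q).filter (fun S => (M.closure S).ncard = f)).card * (f - (q + 1)).choose (m - (q + 1)) := by
  refine (mul_card_levelF_le_sum_spanAll_quart q hq hcirc hC1 hC2 m).trans ?_
  rw [← Finset.sum_filter_add_sum_filter_not (spanAll M q) (fun S => (M.closure S).ncard = f), add_comm]
  refine add_le_add ?_ ?_
  · rw [Finset.card_eq_sum_ones, Finset.sum_mul]
    refine Finset.sum_le_sum (fun S hS => ?_)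
    rw [one_mul, Finset.mem_filter] at *
    obtain ⟨hSall, hSf⟩ := hS
    refine (card_fibreS_le_choose q hSall m).trans (Nat.choose_le_choose _ ?_)
    rw [ncard_closure_diff_of_mem_spanAll hSall]
    obtain ⟨hSE, -, hSr⟩ := mem_spanAll.1 hSall
    have hcl : (M.closure S).ncard ≤ f :=
      hflat _ (M.closure_subset_ground S) (by rw [M.eRk_closure_eq, hSr])
    omega
  · rw [Finset.card_eq_sum_ones, Finset.sum_mul]
    refine Finset.sum_le_sum (fun S hS => ?_)
    rw [one_mul, Finset.mem_filter] at *
    obtain ⟨hSall, hSf⟩ := hS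
    refine (card_fibreS_le_choose q hSall m).trans (Nat.choose_le_choose _ ?_)
    rw [ncard_closure_diff_of_mem_spanAll hSall, hSf]

open scoped Classical in
/-- **THE GRADED PARTITION COUNT OVER SPANNING SETS, WITH A SIZE BOUND `D` AND THE INDEPENDENT `q`-SETS EXPLICIT** (the quart count
`ncard_eRk_eq_ncard_le_le_sets_indep_quart` with the maximal-closure class weighed separately):
`#{B ⊆ E : r(B) = q, |B| ≤ D} ≤ #{B : |B| = q, r(B) = q} + σ_lo·Σ_k s_k·C(n − k, q + 1 − k) + (σ_hi − σ_lo)·N`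
for any `N ≥ #{S ∈ spanAll : |cl S| = f}`, `σ_lo = Σ_j C(f − 1 − (q + 1), j)/quart(j + 1)`, `σ_hi = Σ_j C(f − (q + 1), j)/quart(j + 1)`
(sums to `D − q − 1`). -/
theorem ncard_eRk_eq_ncard_le_le_sets_indep_graded (M : Matroid α) [M.Finite] (q f D : ℕ) (hq : 1 ≤ q)
    (hcirc : ∀ C, M.IsCircuit C → 3 ≤ C.encard) (hC1 : ∀ L ⊆ M.E, M.eRk L = 2 → L.ncard ≤ 3)
    (hC2 : ∀ L ⊆ M.E, M.eRk L ≤ 3 → L.ncard ≤ 6)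
    (hflat : ∀ X ⊆ M.E, M.eRk X ≤ q → X.ncard ≤ f)
    (N : ℕ) (hN : ((spanAll M q).filter (fun S => (M.closure S).ncard = f)).card ≤ N) :
    ({B : Set α | B ⊆ M.E ∧ M.eRk B = q ∧ B.ncard ≤ D}.ncard : ℚ) ≤
      ({B : Set α | B ⊆ M.E ∧ B.ncard = q ∧ M.eRk B = q}.ncard : ℚ) +
        (∑ j ∈ Finset.range (D - (q + 1) + 1), ((f - 1 - (q + 1)).choose j : ℚ) / (((j + 1) + 3 * (j + 1).choose 2 + 3 * (j + 1).choose 3 + 2 * (j + 1).choose 4 : ℕ) : ℚ)) *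
          (∑ k ∈ Finset.Icc 3 (q + 1),
            ({C | M.IsCircuit C ∧ C.ncard = k}.ncard : ℚ) * ((M.E.ncard - k).choose (q + 1 - k) : ℚ)) +
        ((∑ j ∈ Finset.range (D - (q + 1) + 1), ((f - (q + 1)).choose j : ℚ) / (((j + 1) + 3 * (j + 1).choose 2 + 3 * (j + 1).choose 3 + 2 * (j + 1).choose 4 : ℕ) : ℚ)) -
          (∑ j ∈ Finset.range (D - (q + 1) + 1), ((f - 1 - (q + 1)).choose j : ℚ) / (((j + 1) + 3 * (j + 1).choose 2 + 3 * (j + 1).choose 3 + 2 * (j + 1).choose 4 : ℕ) : ℚ))) *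
          (N : ℚ) := by
  set S := {B : Set α | B ⊆ M.E ∧ M.eRk B = q ∧ B.ncard ≤ D} with hS
  set S₁ := {B : Set α | B ⊆ M.E ∧ B.ncard = q ∧ M.eRk B = q} with hS₁
  set S₂ := {B : Set α | B ⊆ M.E ∧ M.eRk B = q ∧ q < B.ncard ∧ B.ncard ≤ D} with hS₂
  have hsplit : S ⊆ S₁ ∪ S₂ := by
    intro B hB
    have hBfin : B.Finite := M.ground_finite.subset hB.1
    have hle : q ≤ B.ncard := by
      have := M.eRk_le_encard B
      rw [hB.2.1, ← hBfin.cast_ncard_eq] at this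
      exact_mod_cast this
    rcases hle.lt_or_eq with h | h
    · exact Or.inr ⟨hB.1, hB.2.1, h, hB.2.2⟩
    · exact Or.inl ⟨hB.1, h.symm, hB.2.1⟩
  have hS₁fin : S₁.Finite := M.ground_finite.finite_subsets.subset (fun B hB => hB.1)
  have hS₂fin : S₂.Finite := M.ground_finite.finite_subsets.subset (fun B hB => hB.1)
  set Pr := ((spanAll M q).filter (fun S => ¬ (M.closure S).ncard = f)).card with hPr
  set Pm := ((spanAll M q).filter (fun S => (M.closure S).ncard = f)).card with hPm
  have hlevel : ∀ m ∈ Finset.Icc (q + 1) D, ((Matroid.levelF M q m).card : ℚ) ≤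
      ((Pr : ℚ) * ((f - 1 - (q + 1)).choose (m - (q + 1)) : ℚ) + (Pm : ℚ) * ((f - (q + 1)).choose (m - (q + 1)) : ℚ)) /
        (((m - q) + 3 * (m - q).choose 2 + 3 * (m - q).choose 3 + 2 * (m - q).choose 4 : ℕ) : ℚ) := by
    intro m hm
    rw [Finset.mem_Icc] at hm
    have hpos : (0 : ℚ) < (((m - q) + 3 * (m - q).choose 2 + 3 * (m - q).choose 3 + 2 * (m - q).choose 4 : ℕ) : ℚ) := by
      exact_mod_cast (by omega : 0 < (m - q) + 3 * (m - q).choose 2 + 3 * (m - q).choose 3 + 2 * (m - q).choose 4)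
    rw [le_div_iff₀ hpos]
    have h := mul_card_levelF_le_classes_graded q f hq hcirc hC1 hC2 hflat m
    have h' : ((((m - q) + 3 * (m - q).choose 2 + 3 * (m - q).choose 3 + 2 * (m - q).choose 4) * (Matroid.levelF M q m).card : ℕ) : ℚ) ≤
        ((Pr * (f - 1 - (q + 1)).choose (m - (q + 1)) + Pm * (f - (q + 1)).choose (m - (q + 1)) : ℕ) : ℚ) := by
      exact_mod_cast h
    push_cast at h' ⊢
    linarith
  have hS₂q : (S₂.ncard : ℚ) ≤ ∑ m ∈ Finset.Icc (q + 1) D,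
      ((Pr : ℚ) * ((f - 1 - (q + 1)).choose (m - (q + 1)) : ℚ) + (Pm : ℚ) * ((f - (q + 1)).choose (m - (q + 1)) : ℚ)) /
        (((m - q) + 3 * (m - q).choose 2 + 3 * (m - q).choose 3 + 2 * (m - q).choose 4 : ℕ) : ℚ) := by
    calc (S₂.ncard : ℚ) ≤ ((∑ m ∈ Finset.Icc (q + 1) D, (Matroid.levelF M q m).card : ℕ) : ℚ) := by
          exact_mod_cast Matroid.ncard_dep_le_sum_levelF q D
      _ = ∑ m ∈ Finset.Icc (q + 1) D, ((Matroid.levelF M q m).card : ℚ) := by push_cast; rfl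
      _ ≤ _ := Finset.sum_le_sum hlevel
  have hre : ∑ m ∈ Finset.Icc (q + 1) D,
      ((Pr : ℚ) * ((f - 1 - (q + 1)).choose (m - (q + 1)) : ℚ) + (Pm : ℚ) * ((f - (q + 1)).choose (m - (q + 1)) : ℚ)) /
        (((m - q) + 3 * (m - q).choose 2 + 3 * (m - q).choose 3 + 2 * (m - q).choose 4 : ℕ) : ℚ) =
      ∑ j ∈ Finset.range (D - q),
      ((Pr : ℚ) * ((f - 1 - (q + 1)).choose j : ℚ) + (Pm : ℚ) * ((f - (q + 1)).choose j : ℚ)) /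
        (((j + 1) + 3 * (j + 1).choose 2 + 3 * (j + 1).choose 3 + 2 * (j + 1).choose 4 : ℕ) : ℚ) := by
    rw [show Finset.Icc (q + 1) D = Finset.image (fun j => q + 1 + j) (Finset.range (D - q)) from ?_]
    · rw [Finset.sum_image (fun a _ b _ h => by omega)]
      apply Finset.sum_congr rfl
      intro j _
      rw [show q + 1 + j - (q + 1) = j by omega, show q + 1 + j - q = j + 1 by omega]
    · ext m
      rw [Finset.mem_Icc, Finset.mem_image]
      constructor
      · intro hm
        exact ⟨m - (q + 1), by rw [Finset.mem_range]; omega, by omega⟩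
      · rintro ⟨j, hj, rfl⟩
        rw [Finset.mem_range] at hj
        omega
  have hrange : Finset.range (D - q) ⊆ Finset.range (D - (q + 1) + 1) := Finset.range_mono (by omega)
  set σl : ℚ := ∑ j ∈ Finset.range (D - (q + 1) + 1), ((f - 1 - (q + 1)).choose j : ℚ) / (((j + 1) + 3 * (j + 1).choose 2 + 3 * (j + 1).choose 3 + 2 * (j + 1).choose 4 : ℕ) : ℚ) with hσl
  set σh : ℚ := ∑ j ∈ Finset.range (D - (q + 1) + 1), ((f - (q + 1)).choose j : ℚ) / (((j + 1) + 3 * (j + 1).choose 2 + 3 * (j + 1).choose 3 + 2 * (j + 1).choose 4 : ℕ) : ℚ) with hσh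
  have hS₂q' : (S₂.ncard : ℚ) ≤ (Pr : ℚ) * σl + (Pm : ℚ) * σh := by
    rw [hσl, hσh, Finset.mul_sum, Finset.mul_sum, ← Finset.sum_add_distrib]
    refine hS₂q.trans (hre.le.trans ?_)
    refine Finset.sum_le_sum_of_subset_of_nonneg hrange (fun j _ _ => by positivity) |>.trans' ?_
    apply le_of_eq
    apply Finset.sum_congr rfl
    intro j _
    field_simp
  -- the class counts: `Pr + Pm = #spanAll ≤ Σ_k s_k·C(n − k, q + 1 − k)`
  have hpart : Pr + Pm = (spanAll M q).card := by
    rw [hPr, hPm, add_comm]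
    exact Finset.card_filter_add_card_filter_not _
  have hFq : ((spanAll M q).card : ℚ) ≤ ∑ k ∈ Finset.Icc 3 (q + 1),
      ({C | M.IsCircuit C ∧ C.ncard = k}.ncard : ℚ) * ((M.E.ncard - k).choose (q + 1 - k) : ℚ) := by
    have h1 := card_spanAll_le q hcirc
    have h2 := Matroid.card_pairsF_le' (M := M) q
    have : (((spanAll M q).card : ℕ) : ℚ) ≤ ((∑ k ∈ Finset.Icc 3 (q + 1),
        {C | M.IsCircuit C ∧ C.ncard = k}.ncard * (M.E.ncard - k).choose (q + 1 - k) : ℕ) : ℚ) := by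
      exact_mod_cast h1.trans h2
    push_cast at this
    exact this
  -- the weights: `σ_lo ≤ σ_hi` termwise
  have hσl0 : (0 : ℚ) ≤ σl := Finset.sum_nonneg (fun j _ => by positivity)
  have hlh : σl ≤ σh := by
    apply Finset.sum_le_sum
    intro j _
    have : (f - 1 - (q + 1)).choose j ≤ (f - (q + 1)).choose j := Nat.choose_le_choose j (by omega)
    have h' : ((f - 1 - (q + 1)).choose j : ℚ) ≤ ((f - (q + 1)).choose j : ℚ) := by exact_mod_cast this
    exact div_le_div_of_nonneg_right h' (by positivity)
  have hSq : (S.ncard : ℚ) ≤ (S₁.ncard : ℚ) + (S₂.ncard : ℚ) := by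
    have : S.ncard ≤ S₁.ncard + S₂.ncard :=
      (ncard_le_ncard hsplit (hS₁fin.union hS₂fin)).trans (ncard_union_le _ _)
    exact_mod_cast this
  have hpartq : (Pr : ℚ) + Pm = ((spanAll M q).card : ℚ) := by exact_mod_cast hpart
  have hPmq : (Pm : ℚ) ≤ N := by exact_mod_cast hN
  have hPr0 : (0 : ℚ) ≤ Pr := Nat.cast_nonneg _
  have hPm0 : (0 : ℚ) ≤ Pm := Nat.cast_nonneg _
  -- `σl·Pr + σh·Pm = σl·(Pr + Pm) + (σh − σl)·Pm ≤ σl·#spanAll + (σh − σl)·N`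
  have key : (Pr : ℚ) * σl + (Pm : ℚ) * σh ≤ ((spanAll M q).card : ℚ) * σl + (σh - σl) * N := by
    rw [← hpartq]
    nlinarith [mul_le_mul_of_nonneg_left hPmq (by linarith : (0 : ℚ) ≤ σh - σl)]
  have e1 := mul_le_mul_of_nonneg_right hFq hσl0
  calc (S.ncard : ℚ) ≤ (S₁.ncard : ℚ) + (S₂.ncard : ℚ) := hSq
    _ ≤ _ := by linarith [hS₂q', key, e1]

end S2

end PercRepro
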